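import Literature.Algebra.Lie.LefschetzModuleWeylOperatorScaled
import Literature.Algebra.Lie.LefschetzModuleHorizontalSubalgebra
import Mathlib.LinearAlgebra.Matrix.SpecialLinearGroup
import HarnessLib

/-!
# Integrating a Lefschetz module to a representation of `SL₂(K)`: `(1 a ; 0 1) ↦ exp(a e)`, `(1 0 ; a 1) ↦ exp(a f)`,
# `(0 −1 ; 1 0) ↦ w`, `diag(t, t⁻¹) ↦ tʰ` (Beauville 2010, §3: the morphism `SL₂ → Corr(A)` through Demazure's presentation)

Topic `Literature/Algebra/Lie` (namespace `Literature.Algebra.Lie`).  Lane `lit-hodgefound` (Track 2 foundations library), prover seat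
`lit-hodgefound-p34` (generation 38, row g38-#1); a sequel of `LefschetzModule.lean` (row A1-88: `degreeSpace`, `IsZGrading`,
`HasLefschetzProperty`, the partner `f = HasLefschetzProperty.dual`), `LefschetzModuleWeylOperator.lean` (p34 g31-#1: the Weyl operator
`w = exp(f) exp(−e) exp(f)`, `w e = −f w`, `w f = −e w`, `w (eʲ p) = (−1)^{k+j} (j!/(k−j)!) e^{k−j} p`, `w² = (−1)^m` on `M_m`, `w⁴ = 1`) and
`LefschetzModuleWeylOperatorScaled.lean` (p08 g40-#1: the rescaled pair `(h, c e)` with partner `c⁻¹ f` and Weyl operator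
`w_c = exp(c⁻¹ f) exp(−c e) exp(c⁻¹ f)`, its string formula).  TWO DEFINITIONS WITH BODIES (`IsZGrading.torus` — the one-parameter torus
`tʰ`; `HasLefschetzProperty.sl2RepFun` / the bundled `HasLefschetzProperty.sl2Rep : SL(2, K) →* End_K(M)` — so three `def`s, the
third being the `MonoidHom` packaging of the second) and theorems; no named fact, no instance, no notation (D-0026 net debt `0`).
As in the parent files, Mathlib's finite exponential `IsNilpotent.exp` wants a `ℚ`-algebra; `End_K(M)` is given the `ℚ`-algebra structure
through `ℚ → K` (`Algebra.compHom`, a `letI` in statements, definitions and proofs, never an instance).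

THE SETTING.  `K` a field of characteristic `0`, `(M, h, e)` a finite-dimensional Lefschetz module (`hgr : IsZGrading h`: `M = ⊕_{m∈ℤ} M_m`,
`h = m` on `M_m`; `L : HasLefschetzProperty h e`: `e M_m ⊆ M_{m+2}`, `eᵏ : M_{−k} ⥲ M_k`), `f = L.dual hgr` its partner (`(e, h, f)` an
`𝔰𝔩₂`-triple), `w = L.weylOperator hgr`.  On `H•(X) = ⋀H¹(X)` of a polarized abelian variety (`e = L_θ = θ ∧ ·`, `f = Λ`, `h = k − g` on `Hᵏ`)
this is the situation of Beauville's theorem, read back in the sequel row g38-#2 (`Motives/`): there `exp(a e) = e^{aθ} ∧ ·`,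
`exp(a f) = a^g e^{θ/a} ⋆ ·`, `w = ℱ` (the Fourier transform), `tʰ = t^{−g} t^*`.

## Source, VERBATIM (held text `paper:arxiv-0805.1541`, p0003–p0005)

A. Beauville, *The action of `SL₂` on abelian varieties*, J. Ramanujan Math. Soc. **25** (2010) 253–263 [Beauville2010SL2]. §3: "We will now
show that the homomorphism `SL₂(ℤ) → Corr(A)^*` extends to the algebraic group `SL₂` over `ℚ`. The essential tool is the description of `SL₂`
by generators and relations given (in a much more general set-up) in [D], Theorem 6.2. We denote by `B` the upper triangular Borel subgroup
of `SL₂`. We still denote by `w` and `u` the elements `(0 −1 ; 1 0)` and `(1 0 ; 1 1)` [sic; `u = (1 1 ; 0 1)` in §2] […] **Proposition** Let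
`H` be a `ℚ`-group. Suppose given a morphism of `ℚ`-groups `β : B → H` and an element `h ∈ H(ℚ)`. Assume that: (i) `h β(t) h⁻¹ = β(t⁻¹)` for
`t` in the maximal torus of `B`; (ii) `h² = (β(u) h)³ = β(−I)` in `H(ℚ)`. Then there is a (unique) morphism of `ℚ`-groups `φ : SL₂ → H`
extending `β` and mapping `w` to `h`." — "**Theorem** Let `A` be an abelian variety, of dimension `g`, with a polarization `θ` of degree `d`.
There is a morphism of `ℚ`-groups `φ : SL₂ → Corr(A)` such that, for `n ∈ ℤ ∖ {0}`, `a ∈ ℚ`: `φ(n 0 ; 0 n⁻¹) = n^{−g} Γ'_n`,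
`φ(0 −1 ; 1 0) = d⁻¹ e^℘`, `φ(1 a ; 0 1) = Δ_* e^{aθ}`, `φ(1 0 ; a 1) = d⁻¹ a^g e^{δ^*θ/a}`. The corresponding Lie algebra homomorphism
`Lφ : 𝔰𝔩₂ → Corr(A)` is given, in the standard basis `(X, Y, H)` of `𝔰𝔩₂`, by: `Lφ(X) = Δ_*θ`, `Lφ(Y) = δ^*θ^{g−1}/(d(g−1)!)`,
`Lφ(H) = Σᵢ (i−g) πᵢ`." — proof: "To define `β` we write `B` as a semi-direct product `𝔾_a ⋊ 𝔾_m`. We define `α : 𝔾_a → Corr(A)` by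
`a ↦ Δ_* e^{aθ}` […] We define `τ : 𝔾_m → Corr(A)` by `τ(t) = t^{−g} Σᵢ tⁱ πᵢ` […] we must check the commutation relation
`τ(t) α(a) τ(t)⁻¹ = α(t²a)` […] Condition (i) can be written `τ(t) h τ(t) = h` […] put `v = (1 0 ; 1 1)`; we have `v = uwu` […] Now we use
the equality `(t 0 ; 0 t⁻¹)(1 0 ; 1 1)(t⁻¹ 0 ; 0 t) = (1 0 ; t⁻² 1)`". §4 **Theorem**: "`(n 0 ; 0 n⁻¹)·z = n^{−g} n^*z`, `(0 −1 ; 1 0)·z = ℱ(z)`,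
`(1 a ; 0 1)·z = e^{aθ} z`, `(1 0 ; a 1)·z = d⁻¹ a^g e^{θ/a} ⋆ z`. The corresponding action of the Lie algebra `𝔰𝔩₂` is given by:
`Xz = θz`, `Yz = d⁻¹ (θ^{g−1}/(g−1)!) ⋆ z`, `Hz = (2p−g−s) z` for `z ∈ CH^p_s(A)`."
Y. André, *Pour une théorie inconditionnelle des motifs*, Publ. Math. IHÉS **83** (1996) [Andre1996Motifs], §1.2 (p. 11): the
representation `ᶜΛ ↦ (0 1 ; 0 0)`, `L ↦ (0 0 ; 1 0)`, `h ↦ (1 0 ; 0 −1)` of `𝔰𝔩₂` on `H*(X)` and "l'élément `(0 1 ; −1 0)` de `SL₂`".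

## The dictionary and how the printed proof is followed

Under `e ↦ X = (0 1 ; 0 0)`, `f ↦ Y = (0 0 ; 1 0)`, `h ↦ H = diag(1, −1)` (Beauville's standard basis; `Lφ(X) = Δ_*θ` is the Lefschetz
operator `e`, `Lφ(Y)` its partner `f`, `Lφ(H) = Σ (i−g)πᵢ` the grading `h`): `exp(a e) ↔ x₊(a) = (1 a ; 0 1) = exp(aX)`,
`exp(a f) ↔ x₋(a) = (1 0 ; a 1)`, the torus `tʰ` (`t^m` on `M_m`, §1) `↔ diag(t, t⁻¹) = "exp(log t · H)"`, and the tree's Weyl operator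
`w = exp(f) exp(−e) exp(f) = exp(−e) exp(f) exp(−e) ↔ x₋(1) x₊(−1) x₋(1) = (0 −1 ; 1 0) = w` (Beauville's `w`; André's `(0 1 ; −1 0)` in his
transposed convention `L ↦ (0 0 ; 1 0)` is the same operator).  Beauville constructs `φ` from Demazure's presentation: a morphism on
`B = 𝔾_a ⋊ 𝔾_m` (the commutation relation `τ(t)α(a)τ(t)⁻¹ = α(t²a)` — here `torus_mul_exp_smul_e`), an element `h = w` with (i)
`h β(t) h⁻¹ = β(t⁻¹)` (here `torus_mul_weylOperator`) and (ii) `h² = β(−I)` (here `weylOperator_mul_weylOperator : w² = (−1)ʰ`),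
`(β(u)h)³ = h²` (the braid relation; in the tree as p34 g37-#6 `exp_mul_weylOperator_pow_three`), and his polynomial-identity argument
"it suffices to check it for `t ∈ ℤ`" for the rescaled relation `(t 0 ; 0 t⁻¹)(1 0 ; 1 1)(t⁻¹ 0 ; 0 t) = (1 0 ; t⁻² 1)`.  On an abstract
module over an arbitrary field of characteristic `0` we do not have Demazure's theorem; instead the representation is WRITTEN DOWN on the
Bruhat decomposition `SL₂ = B ⊔ B w B` — `ρ(a b ; 0 a⁻¹) = exp(ab·e) aʰ`, `ρ(a b ; c d) = exp((a/c) e) w cʰ exp((d/c) e)` (`c ≠ 0`), §3 —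
and its multiplicativity is PROVED (`sl2RepFun_mul`) by peeling generators off the right (`sl2RepFun_mul_of_coe_eq_upper/_diagonal/_weyl`),
which needs exactly Beauville's relations (i), (ii), the Borel commutation relation, and ONE rescaled relation valid for ALL `c ∈ K^×`
(not only squares or integers): **`cʰ w = exp(−c e) exp(c⁻¹ f) exp(−c e)`** (`torus_mul_weylOperator_eq_exp_e`, §2), i.e.
`diag(c, c⁻¹) w = x₊(−c) x₋(c⁻¹) x₊(−c)`, equivalently the Steinberg relation `w x₊(v) w = x₊(−v⁻¹) w diag(v, v⁻¹) x₊(−v⁻¹)`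
(`weylOperator_mul_exp_smul_e_mul_weylOperator`).  It is obtained WITHOUT a polynomial-identity argument from the RESCALED LEFSCHETZ PAIR
`(h, c e)` of `LefschetzModuleWeylOperatorScaled` (Looijenga–Lunts: "`f_{ta} = t⁻¹ f_a`"): its Weyl operator `w_c = exp(c⁻¹f) exp(−c e) exp(c⁻¹f)`
is computed on every `𝔰𝔩₂`-string by the parent files, and comparing string formulas gives **`w_c = cʰ ∘ w`**
(`weylOperator_smul_eq_torus_mul_weylOperator`); conjugating by `w` (`w exp(s e) w⁻¹ = exp(−s f)`) turns the first braid form into the second.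

## Contents (all proved; `f = L.dual hgr`, `w = L.weylOperator hgr`, `tʰ = hgr.torus t`, `ρ = L.sl2Rep hgr`)

* §0 (private) `mul_exp_eq_exp_mul_of_mul_eq` (`A B = C A ⇒ A exp B = exp C · A`), `exp_smul_mul_exp_smul` (`exp(s a) exp(t a) = exp((s+t) a)`);
  extensionality on the degrees `M_m` is the tree's `IsZGrading.linearMap_ext` (`LefschetzModuleHorizontalSubalgebra`).
* §1 **`IsZGrading.torus`** (`tʰ`: `t^m` on `M_m`, glued along `M = ⊕ M_m`), `torus_apply_of_mem`, `torus_apply_mem`, `torus_one`,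
  **`torus_mul`** (`(st)ʰ = sʰ tʰ`), `torus_mul_comm`, **`torus_mul_eq_smul_mul_torus_of_mapsTo`** (`tʰ g = t^d g tʰ` for `g` of degree `d`).
* §2 `torus_mul_e` / `torus_mul_dual` (`tʰ e = t² e tʰ`, `tʰ f = t⁻² f tʰ`), **`torus_mul_exp_smul_e`** (`tʰ exp(s e) = exp(t²s e) tʰ` —
  "`τ(t)α(a)τ(t)⁻¹ = α(t²a)`"), `torus_mul_exp_smul_dual`, `exp_smul_e_mul_torus`, **`torus_mul_weylOperator`** (`tʰ w = w t⁻ʰ` — (i)),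
  **`weylOperator_mul_weylOperator`** (`w² = (−1)ʰ` — (ii)), `weylOperator_mul_weylOperator_pow_three` (`w · w³ = 1`),
  **`weylOperator_mul_exp_smul_e`** / `weylOperator_mul_exp_smul_dual` (`w exp(s e) = exp(−s f) w`, `w exp(s f) = exp(−s e) w`),
  **`weylOperator_smul_eq_torus_mul_weylOperator`** (`w_c = cʰ w`), **`torus_mul_weylOperator_eq_exp_dual`** (`cʰ w = exp(c⁻¹f) exp(−c e) exp(c⁻¹f)`),
  **`torus_mul_weylOperator_eq_exp_e`** (`cʰ w = exp(−c e) exp(c⁻¹f) exp(−c e)`), **`exp_weyl_exp_weyl_exp`** (`exp(u⁻¹e) w exp(u e) w exp(u⁻¹e)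
  = w uʰ`), **`weylOperator_mul_exp_smul_e_mul_weylOperator`** (`w exp(v e) w = exp(−v⁻¹e) w vʰ exp(−v⁻¹e)`, `v ≠ 0`).
* §3 **`sl2RepFun`** (the Bruhat normal form), `sl2RepFun_apply_of_eq_zero` / `_of_ne_zero`, **`sl2RepFun_mul_of_coe_eq_upper`**,
  **`sl2RepFun_mul_of_coe_eq_diagonal`**, **`sl2RepFun_mul_of_coe_eq_weyl`** (right multiplication by `x₊(s)`, `diag(t,t⁻¹)`, `w`), `sl2RepFun_one`,
  **`sl2RepFun_mul`** (MULTIPLICATIVITY), **`sl2Rep : SL(2, K) →* Module.End K M`**, `sl2Rep_apply`.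
* §4 THE VALUES (Beauville's four formulas, abstractly): **`sl2Rep_apply_of_coe_eq_upper`** (`ρ(1 a ; 0 1) = exp(a e)`),
  **`sl2Rep_apply_of_coe_eq_diagonal`** (`ρ(diag(t, t⁻¹)) = tʰ`), **`sl2Rep_apply_of_coe_eq_weyl`** (`ρ(0 −1 ; 1 0) = w`),
  **`sl2Rep_apply_of_coe_eq_lower`** (`ρ(1 0 ; a 1) = exp(a f)`), `sl2Rep_neg_one` (`ρ(−1) = w²`), `sl2Rep_transvection` (values on Mathlib's
  `SpecialLinearGroup.transvection`), **`sl2Rep_unique`** (a homomorphism with these values on the unipotents `(1 a ; 0 1)`, `(1 0 ; a 1)` is `ρ` —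
  `SL₂(K)` is generated by transvections, Mathlib's `Matrix.SL2.transvection_induction`; "(unique) morphism"), `sl2Rep_apply_mem_of_coe_eq_weyl`,
  **`sl2Rep_mem_adjoin_pair_dual`** (`ρ(γ) ∈ K[e, f]` for all `γ`).

TWIN NOTICE (RULING 29 bis): `Literature.RepresentationTheory.AlgebraicGroups.Sl2Rep.rep` (`Sl2StringRep.lean`, for Chevalley's
existence theorem) integrates an `𝔰𝔩₂`-triple `(H, E, F)` to `SL(2, k) →* End V` through string bases and the symmetric powers `Sym^m`,
under `[IsAlgClosed k]`; it is neither imported nor restated.  The present construction is basis-free, works over ANY field of characteristic `0`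
(the lane's Hodge structures live over `ℚ`), is phrased for the tree's Lefschetz modules `(h, e)` with `IsZGrading h`, and identifies the image of
the Weyl element with the tree's `weylOperator` (hence, on `⋀H¹`, with the Fourier transform).  Not here: the Lie-algebra clause `Lφ`
(differentiation), the `ℚ`-group (functor-of-points) formulation, and the `⋀W` / correspondence reading (row g38-#2).

## References

* [Beauville2010SL2] A. Beauville, *The action of SL₂ on abelian varieties*, J. Ramanujan Math. Soc. 25 (2010) 253–263, arXiv:0805.1541,
  §3 (Proposition = Demazure's presentation [SGA 3, Exp. XX, Thm. 6.2]; Theorem and its proof), §4 (Theorem).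
* [Andre1996Motifs] Y. André, *Pour une théorie inconditionnelle des motifs*, Publ. Math. IHÉS 83 (1996) 5–49, §1.2 (p. 11).
* [LooijengaLunts1997] E. Looijenga, V. A. Lunts, *A Lie algebra attached to a projective variety*, Invent. Math. 129 (1997), §1 (1.1)
  ("`f_{ta} = t⁻¹ f_a`"; graded vector spaces `M = ⊕ M_m`).
-/

noncomputable section

namespace Literature.Algebra.Lie

open Module Function Set
open scoped Nat MatrixGroups
open HasLefschetzProperty (primitiveSpace mem_primitiveSpace_iff)

variable {K : Type*} [Field K] {M : Type*} [AddCommGroup M] [Module K M] {h e : Module.End K M}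

/-! ### §0 Preliminaries: finite exponentials with coefficients in `K`, intertwining -/

section Prelim

variable [CharZero K]

/-- The finite exponential of an operator with `aⁿ = 0`, with coefficients in `K`: `exp a = Σ_{i<n} aⁱ/i!`. [folklore] -/
private theorem exp_eq_sum_range {a : Module.End K M} {n : ℕ} (ha : a ^ n = 0) :
    letI := Algebra.compHom (Module.End K M) (algebraMap ℚ K)
    IsNilpotent.exp a = ∑ i ∈ Finset.range n, ((i ! : ℕ) : K)⁻¹ • a ^ i := by
  letI := Algebra.compHom (Module.End K M) (algebraMap ℚ K)
  rw [IsNilpotent.exp_eq_sum ha]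
  refine Finset.sum_congr rfl fun i _ ↦ ?_
  rw [Algebra.compHom_smul_def, map_inv₀, map_natCast]

/-- **Intertwining exponentials**: `A B = C A` for nilpotent `B`, `C` implies `A exp(B) = exp(C) A` (`A Bⁱ = Cⁱ A` termwise in the
finite exponential series). [folklore] -/
private theorem mul_exp_eq_exp_mul_of_mul_eq {A B C : Module.End K M} (hABC : A * B = C * A) (hB : IsNilpotent B) (hC : IsNilpotent C) :
    letI := Algebra.compHom (Module.End K M) (algebraMap ℚ K)
    A * IsNilpotent.exp B = IsNilpotent.exp C * A := by
  letI := Algebra.compHom (Module.End K M) (algebraMap ℚ K)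
  obtain ⟨n₁, hn₁⟩ := hB
  obtain ⟨n₂, hn₂⟩ := hC
  have hBn : B ^ max n₁ n₂ = 0 := pow_eq_zero_of_le (le_max_left _ _) hn₁
  have hCn : C ^ max n₁ n₂ = 0 := pow_eq_zero_of_le (le_max_right _ _) hn₂
  have hpow : ∀ i : ℕ, A * B ^ i = C ^ i * A := fun i ↦ by
    induction i with
    | zero => rw [pow_zero, pow_zero, mul_one, one_mul]
    | succ i ih => rw [pow_succ, ← mul_assoc, ih, mul_assoc, hABC, ← mul_assoc, ← pow_succ]
  rw [exp_eq_sum_range hBn, exp_eq_sum_range hCn, Finset.mul_sum, Finset.sum_mul]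
  exact Finset.sum_congr rfl fun i _ ↦ by rw [mul_smul_comm, smul_mul_assoc, hpow]

/-- **`exp(s a) exp(t a) = exp((s + t) a)`** for a nilpotent operator `a`: the one-parameter subgroup `s ↦ exp(s a)` is a homomorphism
`𝔾_a → GL(M)` — Beauville's "`α : 𝔾_a → Corr(A)`, `a ↦ Δ_* e^{aθ}`; this is a morphism of `ℚ`-groups".
[cite: Beauville2010SL2, §3 Theorem (proof, the morphism α)] -/
theorem exp_smul_mul_exp_smul {a : Module.End K M} (ha : IsNilpotent a) (s t : K) :
    letI := Algebra.compHom (Module.End K M) (algebraMap ℚ K)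
    IsNilpotent.exp (s • a) * IsNilpotent.exp (t • a) = IsNilpotent.exp ((s + t) • a) := by
  letI := Algebra.compHom (Module.End K M) (algebraMap ℚ K)
  obtain ⟨n, hn⟩ := ha
  have hs : IsNilpotent (s • a) := ⟨n, by rw [smul_pow, hn, smul_zero]⟩
  have ht : IsNilpotent (t • a) := ⟨n, by rw [smul_pow, hn, smul_zero]⟩
  rw [add_smul, IsNilpotent.exp_add_of_commute (((Commute.refl a).smul_left s).smul_right t) hs ht]

end Prelim

/-! ### §1 The one-parameter torus `tʰ`: `t^m` on `M_m` -/

namespace IsZGrading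

variable [CharZero K]

/-- **The torus `tʰ = diag(t, t⁻¹)` of a `ℤ`-graded `(M, h)`**: the operator acting by `t^m` on `M_m` (glued along
`M = ⊕ₘ M_m`; for `t = 0` the junk value of `0⁻¹ = 0` is used in negative degrees). It is the image of `(t 0 ; 0 t⁻¹) ∈ SL₂`
(Beauville's `τ(t) = t^{−g} Σᵢ tⁱ πᵢ`, "a morphism of ℚ-groups `𝔾_m → Corr(A)`").
[cite: Beauville2010SL2, §3 Theorem (proof, the morphism τ : 𝔾_m → Corr(A))] -/
def torus (hgr : IsZGrading h) (t : K) : Module.End K M :=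
  (DirectSum.toModule K ℤ M fun m ↦ (t ^ m) • (degreeSpace h m).subtype) ∘ₗ
    ((LinearEquiv.ofBijective (DirectSum.coeLinearMap fun m : ℤ ↦ degreeSpace h m)
      (HasLefschetzProperty.isInternal_degreeSpace hgr)).symm : M →ₗ[K] DirectSum ℤ fun m ↦ degreeSpace h m)

/-- `tʰ x = t^m x` for `x ∈ M_m`. [cite: Beauville2010SL2, §3 Theorem (proof, τ(t))] -/
theorem torus_apply_of_mem (hgr : IsZGrading h) (t : K) {m : ℤ} {x : M} (hx : x ∈ degreeSpace h m) :
    hgr.torus t x = (t ^ m) • x := by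
  classical
  rw [torus, LinearMap.comp_apply, LinearEquiv.coe_coe]
  have h1 : (LinearEquiv.ofBijective (DirectSum.coeLinearMap fun m : ℤ ↦ degreeSpace h m)
      (HasLefschetzProperty.isInternal_degreeSpace hgr)).symm x = DirectSum.lof K ℤ (fun m ↦ degreeSpace h m) m ⟨x, hx⟩ := by
    apply (LinearEquiv.ofBijective (DirectSum.coeLinearMap fun m : ℤ ↦ degreeSpace h m)
      (HasLefschetzProperty.isInternal_degreeSpace hgr)).injective
    rw [LinearEquiv.apply_symm_apply, LinearEquiv.ofBijective_apply, DirectSum.lof_eq_of, DirectSum.coeLinearMap_of]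
  rw [h1, DirectSum.toModule_lof, LinearMap.smul_apply, Submodule.subtype_apply]

/-- `tʰ` preserves each `M_m`. [cite: Beauville2010SL2, §3 Theorem (proof, τ(t))] -/
theorem torus_apply_mem (hgr : IsZGrading h) (t : K) {m : ℤ} {x : M} (hx : x ∈ degreeSpace h m) :
    hgr.torus t x ∈ degreeSpace h m := by
  rw [hgr.torus_apply_of_mem t hx]
  exact Submodule.smul_mem _ _ hx

/-- `1ʰ = 1`. [cite: Beauville2010SL2, §3 Theorem (proof, τ a morphism of groups)] -/
theorem torus_one (hgr : IsZGrading h) : hgr.torus 1 = 1 :=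
  hgr.linearMap_ext fun m x hx ↦ by rw [hgr.torus_apply_of_mem 1 hx, one_zpow, one_smul, Module.End.one_apply]

/-- **`(st)ʰ = sʰ tʰ`**: the torus is a homomorphism `K^× → GL(M)`. [cite: Beauville2010SL2, §3 Theorem (proof, "τ is a morphism of ℚ-groups")] -/
theorem torus_mul (hgr : IsZGrading h) (s t : K) : hgr.torus (s * t) = hgr.torus s * hgr.torus t :=
  hgr.linearMap_ext fun m x hx ↦ by
    rw [Module.End.mul_apply, hgr.torus_apply_of_mem t hx, map_smul, hgr.torus_apply_of_mem s hx,
      hgr.torus_apply_of_mem _ hx, mul_zpow, mul_comm, mul_smul]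

/-- `sʰ` and `tʰ` commute. [cite: Beauville2010SL2, §3 Theorem (proof, τ)] -/
theorem torus_mul_comm (hgr : IsZGrading h) (s t : K) : hgr.torus s * hgr.torus t = hgr.torus t * hgr.torus s := by
  rw [← hgr.torus_mul, mul_comm, hgr.torus_mul]

/-- **`tʰ g = t^d · g tʰ` for an operator `g` of degree `d`** (`t ≠ 0`): conjugation by the torus rescales a homogeneous operator
by its weight — Beauville's "`τ(t) α(a) τ(t)⁻¹ = α(t²a)`" for `g = e` (`d = 2`). [cite: Beauville2010SL2, §3 Theorem (proof, the commutation relation of τ and α)] -/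
theorem torus_mul_eq_smul_mul_torus_of_mapsTo (hgr : IsZGrading h) {g : Module.End K M} {d : ℤ}
    (hg : ∀ m : ℤ, MapsTo g (degreeSpace h m) (degreeSpace h (m + d))) {t : K} (ht : t ≠ 0) :
    hgr.torus t * g = (t ^ d) • (g * hgr.torus t) :=
  hgr.linearMap_ext fun m x hx ↦ by
    rw [Module.End.mul_apply, hgr.torus_apply_of_mem t (hg m hx), LinearMap.smul_apply, Module.End.mul_apply,
      hgr.torus_apply_of_mem t hx, map_smul, smul_smul, zpow_add₀ ht, mul_comm]

end IsZGrading

/-! ### §2 The torus and the Weyl operator: `tʰ e = t² e tʰ`, `tʰ w = w t⁻ʰ`, `w² = (−1)ʰ`, `w exp(s e) = exp(−s f) w`,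
the RESCALED Weyl operator `w_c = cʰ w` and the braid relations `cʰ w = exp(c⁻¹f) exp(−c e) exp(c⁻¹f) = exp(−c e) exp(c⁻¹f) exp(−c e)` -/

namespace HasLefschetzProperty

variable [CharZero K] [FiniteDimensional K M]

omit [FiniteDimensional K M] in
/-- **`tʰ e = t² · e tʰ`** (`diag(t, t⁻¹) X₊ diag(t, t⁻¹)⁻¹ = t² X₊`; Beauville: "`τ(t) α(a) τ(t)⁻¹ = α(t²a)`").
[cite: Beauville2010SL2, §3 Theorem (proof)] -/
theorem torus_mul_e (L : HasLefschetzProperty h e) (hgr : IsZGrading h) {t : K} (ht : t ≠ 0) :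
    hgr.torus t * e = (t ^ 2) • (e * hgr.torus t) := by
  rw [hgr.torus_mul_eq_smul_mul_torus_of_mapsTo L.mapsTo ht, zpow_ofNat]

omit [FiniteDimensional K M] in
/-- **`tʰ f = t⁻² · f tʰ`** (`diag(t, t⁻¹) X₋ diag(t, t⁻¹)⁻¹ = t⁻² X₋`). [cite: Beauville2010SL2, §3 Theorem (proof)] -/
theorem torus_mul_dual (L : HasLefschetzProperty h e) (hgr : IsZGrading h) {t : K} (ht : t ≠ 0) :
    hgr.torus t * L.dual hgr = (t⁻¹ ^ 2) • (L.dual hgr * hgr.torus t) := by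
  have h1 := hgr.torus_mul_eq_smul_mul_torus_of_mapsTo (g := L.dual hgr) (d := -2)
    (fun m x hx ↦ by rw [← sub_eq_add_neg]; exact L.dual_apply_mem hgr hx) ht
  rw [h1, zpow_neg, zpow_ofNat, inv_pow]

/-- **`tʰ exp(s e) = exp(t² s e) tʰ`** — the commutation relation "`τ(t) α(a) τ(t)⁻¹ = α(t²a)`" of the Borel subgroup
`B = 𝔾_a ⋊ 𝔾_m`. [cite: Beauville2010SL2, §3 Theorem (proof, "we must check the commutation relation τ(t)α(a)τ(t)⁻¹ = α(t²a)")] -/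
theorem torus_mul_exp_smul_e (L : HasLefschetzProperty h e) (hgr : IsZGrading h) {t : K} (ht : t ≠ 0) (s : K) :
    letI := Algebra.compHom (Module.End K M) (algebraMap ℚ K)
    hgr.torus t * IsNilpotent.exp (s • e) = IsNilpotent.exp ((t ^ 2 * s) • e) * hgr.torus t := by
  refine mul_exp_eq_exp_mul_of_mul_eq ?_ (L.isNilpotent_smul_e hgr s) (L.isNilpotent_smul_e hgr _)
  rw [mul_smul_comm, L.torus_mul_e hgr ht, smul_smul, mul_comm s, smul_mul_assoc]

/-- **`tʰ exp(s f) = exp(t⁻² s f) tʰ`.** [cite: Beauville2010SL2, §3 Theorem (proof)] -/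
theorem torus_mul_exp_smul_dual (L : HasLefschetzProperty h e) (hgr : IsZGrading h) {t : K} (ht : t ≠ 0) (s : K) :
    letI := Algebra.compHom (Module.End K M) (algebraMap ℚ K)
    hgr.torus t * IsNilpotent.exp (s • L.dual hgr) = IsNilpotent.exp ((t⁻¹ ^ 2 * s) • L.dual hgr) * hgr.torus t := by
  refine mul_exp_eq_exp_mul_of_mul_eq ?_ (L.isNilpotent_smul_dual hgr s) (L.isNilpotent_smul_dual hgr _)
  rw [mul_smul_comm, L.torus_mul_dual hgr ht, smul_smul, mul_comm s, smul_mul_assoc]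

/-- **`tʰ w = w (t⁻¹)ʰ`**: the Weyl operator inverts the torus (`w` maps `M_m` to `M_{−m}`) — condition (i)
"`h β(t) h⁻¹ = β(t⁻¹)` for `t` in the maximal torus" of Demazure's presentation. [cite: Beauville2010SL2, §3 Proposition (i) and Theorem (proof, "τ(t) h τ(t) = h")] -/
theorem torus_mul_weylOperator (L : HasLefschetzProperty h e) (hgr : IsZGrading h) (t : K) :
    hgr.torus t * L.weylOperator hgr = L.weylOperator hgr * hgr.torus t⁻¹ :=
  hgr.linearMap_ext fun m x hx ↦ by
    rw [Module.End.mul_apply, Module.End.mul_apply, hgr.torus_apply_of_mem t (L.weylOperator_apply_mem hgr hx),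
      hgr.torus_apply_of_mem t⁻¹ hx, map_smul, inv_zpow', zpow_neg]

omit [CharZero K] [FiniteDimensional K M] in
/-- `(−1)ᵐ` as an integer power equals `(−1)^{|m|}`. [folklore] -/
private theorem neg_one_zpow_eq_pow_natAbs (m : ℤ) : (-1 : K) ^ m = (-1 : K) ^ m.natAbs := by
  rcases Int.even_or_odd m with hm | hm
  · rw [hm.neg_one_zpow, (Int.natAbs_even.2 hm).neg_one_pow]
  · rw [hm.neg_one_zpow, (Int.natAbs_odd.2 hm).neg_one_pow]

/-- **`w² = (−1)ʰ`**: the square of the Weyl operator is the torus element `(−1)ʰ = diag(−1, −1)` — the relation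
"`h² = β(−I)`" of Demazure's presentation. [cite: Beauville2010SL2, §3 Proposition (ii) ("h² = (β(u)h)³ = β(−I)")] [cite: Andre1996Motifs, §1.2 (p. 11)] -/
theorem weylOperator_mul_weylOperator (L : HasLefschetzProperty h e) (hgr : IsZGrading h) :
    L.weylOperator hgr * L.weylOperator hgr = hgr.torus (-1) :=
  hgr.linearMap_ext fun m x hx ↦ by
    rw [Module.End.mul_apply, L.weylOperator_weylOperator_apply_of_mem hgr hx, hgr.torus_apply_of_mem _ hx,
      neg_one_zpow_eq_pow_natAbs]

/-- `w⁴ = 1` in the form `w (w (w (w x))) = x`. [cite: Andre1996Motifs, §1.2 (p. 11)] -/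
theorem weylOperator_mul_weylOperator_pow_three (L : HasLefschetzProperty h e) (hgr : IsZGrading h) :
    L.weylOperator hgr * L.weylOperator hgr ^ 3 = 1 := by
  rw [← pow_succ', L.weylOperator_pow_four hgr]

/-- **`w exp(s e) = exp(−s f) w`** (`w X₊ w⁻¹ = −X₋`: `(0 −1 ; 1 0)(1 s ; 0 1)(0 −1 ; 1 0)⁻¹ = (1 0 ; −s 1)`).
[cite: Beauville2010SL2, §3 Theorem (proof) and §4 Theorem] [cite: Andre1996Motifs, §1.2 (p. 11)] -/
theorem weylOperator_mul_exp_smul_e (L : HasLefschetzProperty h e) (hgr : IsZGrading h) (s : K) :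
    letI := Algebra.compHom (Module.End K M) (algebraMap ℚ K)
    L.weylOperator hgr * IsNilpotent.exp (s • e) = IsNilpotent.exp ((-s) • L.dual hgr) * L.weylOperator hgr := by
  refine mul_exp_eq_exp_mul_of_mul_eq ?_ (L.isNilpotent_smul_e hgr s) (L.isNilpotent_smul_dual hgr _)
  rw [mul_smul_comm, L.weylOperator_mul_e hgr, smul_neg, ← neg_smul, smul_mul_assoc]

/-- **`w exp(s f) = exp(−s e) w`** (`w X₋ w⁻¹ = −X₊`). [cite: Beauville2010SL2, §4 Theorem] [cite: Andre1996Motifs, §1.2 (p. 11)] -/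
theorem weylOperator_mul_exp_smul_dual (L : HasLefschetzProperty h e) (hgr : IsZGrading h) (s : K) :
    letI := Algebra.compHom (Module.End K M) (algebraMap ℚ K)
    L.weylOperator hgr * IsNilpotent.exp (s • L.dual hgr) = IsNilpotent.exp ((-s) • e) * L.weylOperator hgr := by
  refine mul_exp_eq_exp_mul_of_mul_eq ?_ (L.isNilpotent_smul_dual hgr s) (L.isNilpotent_smul_e hgr _)
  rw [mul_smul_comm, L.weylOperator_mul_dual hgr, smul_neg, ← neg_smul, smul_mul_assoc]

/-- **THE RESCALED WEYL OPERATOR IS `cʰ w`: `w_c = cʰ ∘ w`** (`(0 −c ; c⁻¹ 0) = diag(c, c⁻¹)(0 −1 ; 1 0)`): on a string vector `eʲ p`,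
`p ∈ P_{−k}`, both are `(−1)^{k+j} (j!/(k−j)!) c^{k−2j} · e^{k−j} p` (`e^{k−j} p ∈ M_{k−2j}`).
[cite: Beauville2010SL2, §3 Theorem (proof, "τ(t) h τ(t) = h")] [cite: LooijengaLunts1997, §1 (1.1) ("f_{ta} = t⁻¹ f_a")] -/
theorem weylOperator_smul_eq_torus_mul_weylOperator (L : HasLefschetzProperty h e) (hgr : IsZGrading h) {c : K} (hc : c ≠ 0) :
    (L.smul hc).weylOperator hgr = hgr.torus c * L.weylOperator hgr := by
  refine L.linearMap_ext_of_strings hgr fun k p hp j hj ↦ ?_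
  have hpk : (e ^ (k - j)) p ∈ degreeSpace h (-(k : ℤ) + 2 * ((k - j : ℕ) : ℤ)) :=
    L.pow_apply_mem (mem_primitiveSpace_iff.1 hp).1 (k - j)
  rw [L.weylOperator_smul_apply_pow_primitive hgr hc hp hj, Module.End.mul_apply, L.weylOperator_apply_pow_primitive hgr hp hj,
    map_smul, hgr.torus_apply_of_mem c hpk, smul_smul]
  congr 1
  have hexp : c ^ (-(k : ℤ) + 2 * ((k - j : ℕ) : ℤ)) = c⁻¹ ^ j * c ^ (k - j) := by
    rw [show (-(k : ℤ) + 2 * ((k - j : ℕ) : ℤ)) = ((k - j : ℕ) : ℤ) - (j : ℤ) by push_cast [Nat.cast_sub hj]; ring,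
      zpow_sub₀ hc, zpow_natCast, zpow_natCast, div_eq_mul_inv, inv_pow, mul_comm]
  rw [hexp]

/-- **THE BRAID RELATION, FIRST FORM: `cʰ w = exp(c⁻¹ f) exp(−c e) exp(c⁻¹ f)`** (`c ≠ 0`;
`diag(c, c⁻¹)(0 −1 ; 1 0) = (1 0 ; c⁻¹ 1)(1 −c ; 0 1)(1 0 ; c⁻¹ 1)`). [cite: Beauville2010SL2, §3 Theorem (proof)] [cite: Andre1996Motifs, §1.2 (p. 11)] -/
theorem torus_mul_weylOperator_eq_exp_dual (L : HasLefschetzProperty h e) (hgr : IsZGrading h) {c : K} (hc : c ≠ 0) :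
    letI := Algebra.compHom (Module.End K M) (algebraMap ℚ K)
    hgr.torus c * L.weylOperator hgr =
      IsNilpotent.exp (c⁻¹ • L.dual hgr) * IsNilpotent.exp (-(c • e)) * IsNilpotent.exp (c⁻¹ • L.dual hgr) := by
  rw [← L.weylOperator_smul_eq_torus_mul_weylOperator hgr hc, L.weylOperator_smul_def hgr hc]

/-- **THE BRAID RELATION, SECOND FORM: `cʰ w = exp(−c e) exp(c⁻¹ f) exp(−c e)`** (`c ≠ 0`;
`diag(c, c⁻¹)(0 −1 ; 1 0) = (1 −c ; 0 1)(1 0 ; c⁻¹ 1)(1 −c ; 0 1)`) — the first form for `c⁻¹` conjugated by `w`.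
[cite: Beauville2010SL2, §3 Theorem (proof, "v = uwu")] [cite: Andre1996Motifs, §1.2 (p. 11)] -/
theorem torus_mul_weylOperator_eq_exp_e (L : HasLefschetzProperty h e) (hgr : IsZGrading h) {c : K} (hc : c ≠ 0) :
    letI := Algebra.compHom (Module.End K M) (algebraMap ℚ K)
    hgr.torus c * L.weylOperator hgr =
      IsNilpotent.exp (-(c • e)) * IsNilpotent.exp (c⁻¹ • L.dual hgr) * IsNilpotent.exp (-(c • e)) := by
  letI := Algebra.compHom (Module.End K M) (algebraMap ℚ K)
  -- `w (c⁻¹ʰ w) = cʰ w w`, and `w (exp(c f) exp(−c⁻¹ e) exp(c f)) = exp(−c e) exp(c⁻¹ f) exp(−c e) w`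
  have h1 : L.weylOperator hgr * (hgr.torus c⁻¹ * L.weylOperator hgr) = hgr.torus c * L.weylOperator hgr * L.weylOperator hgr := by
    rw [← mul_assoc, ← L.torus_mul_weylOperator hgr c]
  have h2 := L.torus_mul_weylOperator_eq_exp_dual hgr (inv_ne_zero hc)
  rw [inv_inv] at h2
  have h3 : L.weylOperator hgr * (hgr.torus c⁻¹ * L.weylOperator hgr) = IsNilpotent.exp (-(c • e)) *
      IsNilpotent.exp (c⁻¹ • L.dual hgr) * IsNilpotent.exp (-(c • e)) * L.weylOperator hgr := by
    rw [h2, ← mul_assoc, ← mul_assoc, L.weylOperator_mul_exp_smul_dual hgr, mul_assoc _ (L.weylOperator hgr), ← neg_smul,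
      L.weylOperator_mul_exp_smul_e hgr, ← mul_assoc, mul_assoc _ (L.weylOperator hgr), L.weylOperator_mul_exp_smul_dual hgr,
      ← mul_assoc, neg_neg, ← neg_smul]
  have h4 : hgr.torus c * L.weylOperator hgr * L.weylOperator hgr = IsNilpotent.exp (-(c • e)) *
      IsNilpotent.exp (c⁻¹ • L.dual hgr) * IsNilpotent.exp (-(c • e)) * L.weylOperator hgr := by rw [← h1, h3]
  calc hgr.torus c * L.weylOperator hgr
      = hgr.torus c * L.weylOperator hgr * (L.weylOperator hgr * L.weylOperator hgr ^ 3) := by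
        rw [L.weylOperator_mul_weylOperator_pow_three hgr, mul_one]
    _ = (hgr.torus c * L.weylOperator hgr * L.weylOperator hgr) * L.weylOperator hgr ^ 3 := by simp only [mul_assoc]
    _ = IsNilpotent.exp (-(c • e)) * IsNilpotent.exp (c⁻¹ • L.dual hgr) * IsNilpotent.exp (-(c • e)) *
          (L.weylOperator hgr * L.weylOperator hgr ^ 3) := by
        rw [h4]; simp only [mul_assoc]
    _ = _ := by rw [L.weylOperator_mul_weylOperator_pow_three hgr, mul_one]

/-- **THE STEINBERG RELATION: `exp(u⁻¹ e) w exp(u e) w exp(u⁻¹ e) = w uʰ`** for `u ≠ 0` — in `SL₂`: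
`(1 u⁻¹ ; 0 1)(0 −1 ; 1 0)(1 u ; 0 1)(0 −1 ; 1 0)(1 u⁻¹ ; 0 1) = (0 −1 ; 1 0) diag(u, u⁻¹) = (0 −u⁻¹ ; u 0)`; it reduces a word
with two `w`'s to the Bruhat normal form and carries the multiplicativity of the representation below.
[cite: Beauville2010SL2, §3 Theorem (proof, the identity (t 0 ; 0 t⁻¹)(1 0 ; 1 1)(t⁻¹ 0 ; 0 t) = (1 0 ; t⁻² 1))] -/
theorem exp_weyl_exp_weyl_exp (L : HasLefschetzProperty h e) (hgr : IsZGrading h) {u : K} (hu : u ≠ 0) :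
    letI := Algebra.compHom (Module.End K M) (algebraMap ℚ K)
    IsNilpotent.exp (u⁻¹ • e) * L.weylOperator hgr * IsNilpotent.exp (u • e) * L.weylOperator hgr * IsNilpotent.exp (u⁻¹ • e) =
      L.weylOperator hgr * hgr.torus u := by
  letI := Algebra.compHom (Module.End K M) (algebraMap ℚ K)
  -- the second braid form at `c = −u⁻¹`: `(−u⁻¹)ʰ w = exp(u⁻¹ e) exp(−u f) exp(u⁻¹ e)`
  have hB := L.torus_mul_weylOperator_eq_exp_e hgr (neg_ne_zero.2 (inv_ne_zero hu))
  rw [neg_smul, neg_neg, inv_neg, inv_inv, neg_smul] at hB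
  -- `(−1)ʰ` commutes with `exp(s e)`
  have hT1 : ∀ s : K, hgr.torus (-1) * IsNilpotent.exp (s • e) = IsNilpotent.exp (s • e) * hgr.torus (-1) := fun s ↦ by
    rw [L.torus_mul_exp_smul_e hgr (neg_ne_zero.2 one_ne_zero), neg_one_sq, one_mul]
  calc IsNilpotent.exp (u⁻¹ • e) * L.weylOperator hgr * IsNilpotent.exp (u • e) * L.weylOperator hgr * IsNilpotent.exp (u⁻¹ • e)
      = IsNilpotent.exp (u⁻¹ • e) * (L.weylOperator hgr * IsNilpotent.exp (u • e)) * L.weylOperator hgr *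
          IsNilpotent.exp (u⁻¹ • e) := by simp only [mul_assoc]
    _ = IsNilpotent.exp (u⁻¹ • e) * IsNilpotent.exp (-(u • L.dual hgr)) * (L.weylOperator hgr * L.weylOperator hgr) *
          IsNilpotent.exp (u⁻¹ • e) := by
        rw [L.weylOperator_mul_exp_smul_e hgr, neg_smul]; simp only [mul_assoc]
    _ = IsNilpotent.exp (u⁻¹ • e) * IsNilpotent.exp (-(u • L.dual hgr)) * IsNilpotent.exp (u⁻¹ • e) * hgr.torus (-1) := by
        rw [L.weylOperator_mul_weylOperator hgr, mul_assoc _ (hgr.torus (-1)), hT1, ← mul_assoc]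
    _ = hgr.torus (-u⁻¹) * L.weylOperator hgr * hgr.torus (-1) := by rw [hB]
    _ = L.weylOperator hgr * (hgr.torus (-u⁻¹)⁻¹ * hgr.torus (-1)) := by rw [L.torus_mul_weylOperator hgr, mul_assoc]
    _ = L.weylOperator hgr * hgr.torus u := by rw [← hgr.torus_mul, inv_neg, inv_inv, neg_mul_neg, mul_one]


/-- `exp(s e) tʰ = tʰ exp(t⁻² s e)` (`t ≠ 0`). [cite: Beauville2010SL2, §3 Theorem (proof)] -/
theorem exp_smul_e_mul_torus (L : HasLefschetzProperty h e) (hgr : IsZGrading h) {t : K} (ht : t ≠ 0) (s : K) :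
    letI := Algebra.compHom (Module.End K M) (algebraMap ℚ K)
    IsNilpotent.exp (s • e) * hgr.torus t = hgr.torus t * IsNilpotent.exp ((t⁻¹ ^ 2 * s) • e) := by
  rw [L.torus_mul_exp_smul_e hgr ht, ← mul_assoc, ← mul_pow, mul_inv_cancel₀ ht, one_pow, one_mul]

omit [FiniteDimensional K M] in
/-- `exp(0 · e) = 1`. [folklore] -/
private theorem exp_zero_smul (a : Module.End K M) :
    letI := Algebra.compHom (Module.End K M) (algebraMap ℚ K)
    IsNilpotent.exp ((0 : K) • a) = 1 := by
  letI := Algebra.compHom (Module.End K M) (algebraMap ℚ K)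
  rw [zero_smul, IsNilpotent.exp_zero]

/-- **`w exp(v e) w = exp(−v⁻¹ e) w vʰ exp(−v⁻¹ e)`** for `v ≠ 0`: the Steinberg relation solved for a word with two Weyl elements
(`(0 −1 ; 1 0)(1 v ; 0 1)(0 −1 ; 1 0) = (−1 0 ; v −1) = (1 −v⁻¹ ; 0 1)(0 −1 ; 1 0) diag(v, v⁻¹) (1 −v⁻¹ ; 0 1)`).
[cite: Beauville2010SL2, §3 Theorem (proof)] -/
theorem weylOperator_mul_exp_smul_e_mul_weylOperator (L : HasLefschetzProperty h e) (hgr : IsZGrading h) {v : K} (hv : v ≠ 0) :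
    letI := Algebra.compHom (Module.End K M) (algebraMap ℚ K)
    L.weylOperator hgr * IsNilpotent.exp (v • e) * L.weylOperator hgr =
      IsNilpotent.exp ((-v⁻¹) • e) * L.weylOperator hgr * hgr.torus v * IsNilpotent.exp ((-v⁻¹) • e) := by
  letI := Algebra.compHom (Module.End K M) (algebraMap ℚ K)
  have hS := L.exp_weyl_exp_weyl_exp hgr hv
  have hX : ∀ s t : K, IsNilpotent.exp (s • e) * IsNilpotent.exp (t • e) = IsNilpotent.exp ((s + t) • e) :=
    exp_smul_mul_exp_smul (L.isNilpotent_of_hasLefschetzProperty hgr)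
  calc L.weylOperator hgr * IsNilpotent.exp (v • e) * L.weylOperator hgr
      = IsNilpotent.exp ((-v⁻¹ + v⁻¹) • e) * (L.weylOperator hgr * IsNilpotent.exp (v • e) * L.weylOperator hgr) *
          IsNilpotent.exp ((v⁻¹ + -v⁻¹) • e) := by rw [neg_add_cancel, add_neg_cancel, exp_zero_smul, one_mul, mul_one]
    _ = IsNilpotent.exp ((-v⁻¹) • e) * (IsNilpotent.exp (v⁻¹ • e) * L.weylOperator hgr * IsNilpotent.exp (v • e) *
          L.weylOperator hgr * IsNilpotent.exp (v⁻¹ • e)) * IsNilpotent.exp ((-v⁻¹) • e) := by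
        rw [← hX, ← hX]; simp only [mul_assoc]
    _ = _ := by rw [hS]; simp only [mul_assoc]

/-! ### §3 The representation `ρ : SL₂(K) → GL(M)` by the Bruhat normal form -/

/-- The operator attached to `γ = (a b ; c d) ∈ SL₂(K)` by its BRUHAT NORMAL FORM: `γ = (1 ab ; 0 1) diag(a, a⁻¹)` if `c = 0` and
`γ = (1 a/c ; 0 1)(0 −1 ; 1 0) diag(c, c⁻¹)(1 d/c ; 0 1)` if `c ≠ 0` (the big cell `B w B`), read with `(1 s ; 0 1) ↦ exp(s e)`,
`(0 −1 ; 1 0) ↦ w`, `diag(t, t⁻¹) ↦ tʰ` — Beauville's `φ(u) = Δ_* e^θ` (cup product with `e^θ = exp` of the Lefschetz operator),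
`φ(w) = d⁻¹ e^℘` (the Weyl element), `τ(t)`.  Multiplicativity is `sl2RepFun_mul`; the bundled homomorphism is `sl2Rep`.
[cite: Beauville2010SL2, §3 Proposition and Theorem] [cite: Andre1996Motifs, §1.2 (p. 11)] -/
def sl2RepFun (L : HasLefschetzProperty h e) (hgr : IsZGrading h) (γ : SL(2, K)) : Module.End K M :=
  letI := Algebra.compHom (Module.End K M) (algebraMap ℚ K)
  open Classical in
  if (γ : Matrix (Fin 2) (Fin 2) K) 1 0 = 0 then
    IsNilpotent.exp (((γ : Matrix (Fin 2) (Fin 2) K) 0 0 * (γ : Matrix (Fin 2) (Fin 2) K) 0 1) • e) *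
      hgr.torus ((γ : Matrix (Fin 2) (Fin 2) K) 0 0)
  else
    IsNilpotent.exp (((γ : Matrix (Fin 2) (Fin 2) K) 0 0 / (γ : Matrix (Fin 2) (Fin 2) K) 1 0) • e) * L.weylOperator hgr *
      hgr.torus ((γ : Matrix (Fin 2) (Fin 2) K) 1 0) *
        IsNilpotent.exp (((γ : Matrix (Fin 2) (Fin 2) K) 1 1 / (γ : Matrix (Fin 2) (Fin 2) K) 1 0) • e)

omit [FiniteDimensional K M] in
/-- The Borel cell: `ρ(a b ; 0 a⁻¹) = exp(ab e) aʰ`. [cite: Beauville2010SL2, §3 Theorem (proof, β = (α, τ) on B = 𝔾_a ⋊ 𝔾_m)] -/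
theorem sl2RepFun_apply_of_eq_zero (L : HasLefschetzProperty h e) (hgr : IsZGrading h) (γ : SL(2, K))
    (hγ : (γ : Matrix (Fin 2) (Fin 2) K) 1 0 = 0) :
    letI := Algebra.compHom (Module.End K M) (algebraMap ℚ K)
    L.sl2RepFun hgr γ = IsNilpotent.exp (((γ : Matrix (Fin 2) (Fin 2) K) 0 0 * (γ : Matrix (Fin 2) (Fin 2) K) 0 1) • e) *
      hgr.torus ((γ : Matrix (Fin 2) (Fin 2) K) 0 0) := by
  rw [sl2RepFun, if_pos hγ]

omit [FiniteDimensional K M] in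
/-- The big cell: `ρ(a b ; c d) = exp((a/c) e) w cʰ exp((d/c) e)` for `c ≠ 0`. [cite: Beauville2010SL2, §3 Theorem (proof)] -/
theorem sl2RepFun_apply_of_ne_zero (L : HasLefschetzProperty h e) (hgr : IsZGrading h) (γ : SL(2, K))
    (hγ : (γ : Matrix (Fin 2) (Fin 2) K) 1 0 ≠ 0) :
    letI := Algebra.compHom (Module.End K M) (algebraMap ℚ K)
    L.sl2RepFun hgr γ = IsNilpotent.exp (((γ : Matrix (Fin 2) (Fin 2) K) 0 0 / (γ : Matrix (Fin 2) (Fin 2) K) 1 0) • e) *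
      L.weylOperator hgr * hgr.torus ((γ : Matrix (Fin 2) (Fin 2) K) 1 0) *
        IsNilpotent.exp (((γ : Matrix (Fin 2) (Fin 2) K) 1 1 / (γ : Matrix (Fin 2) (Fin 2) K) 1 0) • e) := by
  rw [sl2RepFun, if_neg hγ]

omit [CharZero K] [FiniteDimensional K M] in
/-- `ad = 1` on the Borel subgroup (`c = 0`). [folklore] -/
private theorem mul_eq_one_of_eq_zero (γ : SL(2, K)) (hγ : (γ : Matrix (Fin 2) (Fin 2) K) 1 0 = 0) :
    (γ : Matrix (Fin 2) (Fin 2) K) 0 0 * (γ : Matrix (Fin 2) (Fin 2) K) 1 1 = 1 := by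
  have h := γ.det_coe
  rw [Matrix.det_fin_two, hγ, mul_zero, sub_zero] at h
  exact h

omit [CharZero K] [FiniteDimensional K M] in
/-- `ad − bc = 1`. [folklore] -/
private theorem det_eq_one (γ : SL(2, K)) :
    (γ : Matrix (Fin 2) (Fin 2) K) 0 0 * (γ : Matrix (Fin 2) (Fin 2) K) 1 1 -
      (γ : Matrix (Fin 2) (Fin 2) K) 0 1 * (γ : Matrix (Fin 2) (Fin 2) K) 1 0 = 1 := by
  have h := γ.det_coe
  rwa [Matrix.det_fin_two] at h

/-- **`ρ(γ · (1 s ; 0 1)) = ρ(γ) exp(s e)`** (right multiplication by the upper unipotent subgroup).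
[cite: Beauville2010SL2, §3 Theorem (proof, α : 𝔾_a → Corr(A) "is a morphism of ℚ-groups")] -/
theorem sl2RepFun_mul_of_coe_eq_upper (L : HasLefschetzProperty h e) (hgr : IsZGrading h) (γ u : SL(2, K)) {s : K}
    (hu : (u : Matrix (Fin 2) (Fin 2) K) = !![1, s; 0, 1]) :
    letI := Algebra.compHom (Module.End K M) (algebraMap ℚ K)
    L.sl2RepFun hgr (γ * u) = L.sl2RepFun hgr γ * IsNilpotent.exp (s • e) := by
  letI := Algebra.compHom (Module.End K M) (algebraMap ℚ K)
  have hX : ∀ s t : K, IsNilpotent.exp (s • e) * IsNilpotent.exp (t • e) = IsNilpotent.exp ((s + t) • e) :=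
    exp_smul_mul_exp_smul (L.isNilpotent_of_hasLefschetzProperty hgr)
  have e0 : ∀ i, ((γ * u : SL(2, K)) : Matrix (Fin 2) (Fin 2) K) i 0 = (γ : Matrix (Fin 2) (Fin 2) K) i 0 := fun i ↦ by
    simp [hu, Matrix.mul_apply, Fin.sum_univ_two]
  have e1 : ∀ i, ((γ * u : SL(2, K)) : Matrix (Fin 2) (Fin 2) K) i 1 =
      (γ : Matrix (Fin 2) (Fin 2) K) i 0 * s + (γ : Matrix (Fin 2) (Fin 2) K) i 1 := fun i ↦ by
    simp [hu, Matrix.mul_apply, Fin.sum_univ_two]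
  by_cases hc : (γ : Matrix (Fin 2) (Fin 2) K) 1 0 = 0
  · have ha : (γ : Matrix (Fin 2) (Fin 2) K) 0 0 ≠ 0 := left_ne_zero_of_mul_eq_one (mul_eq_one_of_eq_zero γ hc)
    rw [L.sl2RepFun_apply_of_eq_zero hgr _ (by rw [e0, hc]), L.sl2RepFun_apply_of_eq_zero hgr _ hc, e0, e1, mul_assoc,
      L.torus_mul_exp_smul_e hgr ha, ← mul_assoc, hX]
    congr 3
    ring
  · rw [L.sl2RepFun_apply_of_ne_zero hgr _ (by rw [e0]; exact hc), L.sl2RepFun_apply_of_ne_zero hgr _ hc, e0, e0, e1,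
      mul_assoc _ (IsNilpotent.exp _) (IsNilpotent.exp _), hX]
    congr 3
    field_simp
    ring

/-- **`ρ(γ · diag(t, t⁻¹)) = ρ(γ) tʰ`** (right multiplication by the torus). [cite: Beauville2010SL2, §3 Theorem (proof, τ and "τ(t)α(a)τ(t)⁻¹ = α(t²a)")] -/
theorem sl2RepFun_mul_of_coe_eq_diagonal (L : HasLefschetzProperty h e) (hgr : IsZGrading h) (γ u : SL(2, K)) {t : K} (ht : t ≠ 0)
    (hu : (u : Matrix (Fin 2) (Fin 2) K) = !![t, 0; 0, t⁻¹]) :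
    L.sl2RepFun hgr (γ * u) = L.sl2RepFun hgr γ * hgr.torus t := by
  letI := Algebra.compHom (Module.End K M) (algebraMap ℚ K)
  have e0 : ∀ i, ((γ * u : SL(2, K)) : Matrix (Fin 2) (Fin 2) K) i 0 = (γ : Matrix (Fin 2) (Fin 2) K) i 0 * t := fun i ↦ by
    simp [hu, Matrix.mul_apply, Fin.sum_univ_two]
  have e1 : ∀ i, ((γ * u : SL(2, K)) : Matrix (Fin 2) (Fin 2) K) i 1 = (γ : Matrix (Fin 2) (Fin 2) K) i 1 * t⁻¹ := fun i ↦ by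
    simp [hu, Matrix.mul_apply, Fin.sum_univ_two]
  by_cases hc : (γ : Matrix (Fin 2) (Fin 2) K) 1 0 = 0
  · rw [L.sl2RepFun_apply_of_eq_zero hgr _ (by rw [e0, hc, zero_mul]), L.sl2RepFun_apply_of_eq_zero hgr _ hc, e0, e1,
      mul_assoc _ (hgr.torus _) (hgr.torus t), ← hgr.torus_mul]
    congr 3
    field_simp
  · have hct : (γ : Matrix (Fin 2) (Fin 2) K) 1 0 * t ≠ 0 := mul_ne_zero hc ht
    rw [L.sl2RepFun_apply_of_ne_zero hgr _ (by rw [e0]; exact hct), L.sl2RepFun_apply_of_ne_zero hgr _ hc, e0, e0, e1,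
      mul_assoc _ (IsNilpotent.exp _) (hgr.torus t), L.exp_smul_e_mul_torus hgr ht, ← mul_assoc, mul_assoc _ (hgr.torus _) (hgr.torus t),
      ← hgr.torus_mul]
    congr 3
    · field_simp
    · field_simp

/-- **`ρ(γ · (0 −1 ; 1 0)) = ρ(γ) w`** (right multiplication by the Weyl element) — three cases of the Bruhat decomposition of
`γ w`; the generic one (`c ≠ 0 ≠ d`) is the Steinberg relation `w exp(v e) w = exp(−v⁻¹ e) w vʰ exp(−v⁻¹ e)`.
[cite: Beauville2010SL2, §3 Proposition ((i), (ii)) and Theorem (proof)] -/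
theorem sl2RepFun_mul_of_coe_eq_weyl (L : HasLefschetzProperty h e) (hgr : IsZGrading h) (γ u : SL(2, K))
    (hu : (u : Matrix (Fin 2) (Fin 2) K) = !![0, -1; 1, 0]) :
    L.sl2RepFun hgr (γ * u) = L.sl2RepFun hgr γ * L.weylOperator hgr := by
  letI := Algebra.compHom (Module.End K M) (algebraMap ℚ K)
  have hX : ∀ s t : K, IsNilpotent.exp (s • e) * IsNilpotent.exp (t • e) = IsNilpotent.exp ((s + t) • e) :=
    exp_smul_mul_exp_smul (L.isNilpotent_of_hasLefschetzProperty hgr)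
  have e0 : ∀ i, ((γ * u : SL(2, K)) : Matrix (Fin 2) (Fin 2) K) i 0 = (γ : Matrix (Fin 2) (Fin 2) K) i 1 := fun i ↦ by
    simp [hu, Matrix.mul_apply, Fin.sum_univ_two]
  have e1 : ∀ i, ((γ * u : SL(2, K)) : Matrix (Fin 2) (Fin 2) K) i 1 = -(γ : Matrix (Fin 2) (Fin 2) K) i 0 := fun i ↦ by
    simp [hu, Matrix.mul_apply, Fin.sum_univ_two]
  have hdet := det_eq_one γ
  by_cases hc : (γ : Matrix (Fin 2) (Fin 2) K) 1 0 = 0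
  · -- `γ = (a b ; 0 a⁻¹)`, `γ w = (b −a ; a⁻¹ 0)` lies in the big cell
    have had : (γ : Matrix (Fin 2) (Fin 2) K) 0 0 * (γ : Matrix (Fin 2) (Fin 2) K) 1 1 = 1 := mul_eq_one_of_eq_zero γ hc
    have hd : (γ : Matrix (Fin 2) (Fin 2) K) 1 1 ≠ 0 := right_ne_zero_of_mul_eq_one had
    rw [L.sl2RepFun_apply_of_ne_zero hgr _ (by rw [e0]; exact hd), L.sl2RepFun_apply_of_eq_zero hgr _ hc, e0, e0, e1, hc, neg_zero,
      zero_div, exp_zero_smul, mul_one, mul_assoc _ (hgr.torus _) (L.weylOperator hgr), L.torus_mul_weylOperator hgr, ← mul_assoc,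
      eq_inv_of_mul_eq_one_right had]
    congr 3
    rw [div_inv_eq_mul, mul_comm]
  · by_cases hd : (γ : Matrix (Fin 2) (Fin 2) K) 1 1 = 0
    · -- `γ = (a b ; c 0)`, `b = −c⁻¹`, `γ w = (b −a ; 0 −c)` lies in the Borel subgroup
      have hb : (γ : Matrix (Fin 2) (Fin 2) K) 0 1 = -((γ : Matrix (Fin 2) (Fin 2) K) 1 0)⁻¹ := by
        rw [hd] at hdet
        have hbc : (γ : Matrix (Fin 2) (Fin 2) K) 0 1 * (γ : Matrix (Fin 2) (Fin 2) K) 1 0 = -1 := by linear_combination -hdet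
        rw [← mul_inv_cancel_right₀ hc ((γ : Matrix (Fin 2) (Fin 2) K) 0 1), hbc, neg_one_mul]
      rw [L.sl2RepFun_apply_of_eq_zero hgr _ (by rw [e0, hd]), L.sl2RepFun_apply_of_ne_zero hgr _ hc, e0, e1, hd, zero_div,
        exp_zero_smul, mul_one, mul_assoc _ (hgr.torus _) (L.weylOperator hgr), L.torus_mul_weylOperator hgr, ← mul_assoc,
        mul_assoc _ (L.weylOperator hgr) (L.weylOperator hgr), L.weylOperator_mul_weylOperator hgr, mul_assoc, ← hgr.torus_mul, hb,
        neg_one_mul]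
      congr 3
      field_simp
    · -- the generic case `c ≠ 0 ≠ d`: `γ w = (b −a ; d −c)`, Steinberg relation with `v = cd`
      have hcd : (γ : Matrix (Fin 2) (Fin 2) K) 1 0 * (γ : Matrix (Fin 2) (Fin 2) K) 1 1 ≠ 0 := mul_ne_zero hc hd
      have hS := L.weylOperator_mul_exp_smul_e_mul_weylOperator hgr hcd
      rw [L.sl2RepFun_apply_of_ne_zero hgr _ (by rw [e0]; exact hd), L.sl2RepFun_apply_of_ne_zero hgr _ hc, e0, e0, e1]
      -- abbreviations for the entries
      set a := (γ : Matrix (Fin 2) (Fin 2) K) 0 0 with ha_def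
      set b := (γ : Matrix (Fin 2) (Fin 2) K) 0 1 with hb_def
      set c := (γ : Matrix (Fin 2) (Fin 2) K) 1 0 with hc_def
      set d := (γ : Matrix (Fin 2) (Fin 2) K) 1 1 with hd_def
      -- scalar identities
      have h1 : c ^ 2 * (d / c) = c * d := by field_simp
      have h2 : a / c + -(c * d)⁻¹ = b / d := by
        field_simp
        linear_combination hdet
      have h3 : c⁻¹⁻¹ ^ 2 * -(c * d)⁻¹ = -c / d := by field_simp
      have h4 : c * d * c⁻¹ = d := by field_simp
      symm
      calc IsNilpotent.exp ((a / c) • e) * L.weylOperator hgr * hgr.torus c * IsNilpotent.exp ((d / c) • e) * L.weylOperator hgr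
          = IsNilpotent.exp ((a / c) • e) * L.weylOperator hgr * (hgr.torus c * IsNilpotent.exp ((d / c) • e)) * L.weylOperator hgr := by
            simp only [mul_assoc]
        _ = IsNilpotent.exp ((a / c) • e) * (L.weylOperator hgr * IsNilpotent.exp ((c * d) • e) * L.weylOperator hgr) * hgr.torus c⁻¹ := by
            rw [L.torus_mul_exp_smul_e hgr hc, h1, mul_assoc _ _ (L.weylOperator hgr), mul_assoc (IsNilpotent.exp _) (hgr.torus c),
              L.torus_mul_weylOperator hgr]
            simp only [mul_assoc]
        _ = IsNilpotent.exp ((a / c) • e) * IsNilpotent.exp ((-(c * d)⁻¹) • e) * L.weylOperator hgr * hgr.torus (c * d) *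
              (IsNilpotent.exp ((-(c * d)⁻¹) • e) * hgr.torus c⁻¹) := by
            rw [hS]; simp only [mul_assoc]
        _ = IsNilpotent.exp ((b / d) • e) * L.weylOperator hgr * (hgr.torus (c * d) * hgr.torus c⁻¹) *
              IsNilpotent.exp ((-c / d) • e) := by
            rw [hX, h2, L.exp_smul_e_mul_torus hgr (inv_ne_zero hc), h3]; simp only [mul_assoc]
        _ = IsNilpotent.exp ((b / d) • e) * L.weylOperator hgr * hgr.torus d * IsNilpotent.exp ((-c / d) • e) := by
            rw [← hgr.torus_mul, h4]

omit [FiniteDimensional K M] in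
/-- `ρ(1) = 1`. [cite: Beauville2010SL2, §3 Theorem] -/
theorem sl2RepFun_one (L : HasLefschetzProperty h e) (hgr : IsZGrading h) : L.sl2RepFun hgr 1 = 1 := by
  letI := Algebra.compHom (Module.End K M) (algebraMap ℚ K)
  rw [L.sl2RepFun_apply_of_eq_zero hgr 1 (by simp)]
  simp only [Matrix.SpecialLinearGroup.coe_one, Matrix.one_apply_eq, ne_eq, zero_ne_one, not_false_eq_true,
    Matrix.one_apply_ne, mul_zero]
  rw [exp_zero_smul, hgr.torus_one, mul_one]

/-- **MULTIPLICATIVITY `ρ(γσ) = ρ(γ)ρ(σ)`**: write `σ` in Bruhat normal form `(1 ab ; 0 1) diag(a, a⁻¹)` or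
`(1 a/c ; 0 1)(0 −1 ; 1 0) diag(c, c⁻¹)(1 d/c ; 0 1)` and peel the factors off `γσ` from the right
(`sl2RepFun_mul_of_coe_eq_upper/_diagonal/_weyl`) — Demazure's presentation theorem for `SL₂` in Beauville's form: a morphism
on the Borel subgroup `β = (α, τ)` plus an element `h` with (i) `h β(t) h⁻¹ = β(t⁻¹)` and (ii) `h² = (β(u)h)³ = β(−I)` extend uniquely.
[cite: Beauville2010SL2, §3 Proposition and Theorem] -/
theorem sl2RepFun_mul (L : HasLefschetzProperty h e) (hgr : IsZGrading h) (γ σ : SL(2, K)) :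
    L.sl2RepFun hgr (γ * σ) = L.sl2RepFun hgr γ * L.sl2RepFun hgr σ := by
  letI := Algebra.compHom (Module.End K M) (algebraMap ℚ K)
  induction σ using Matrix.SpecialLinearGroup.fin_two_induction with
  | h a b c d hdet =>
  by_cases hc : c = 0
  · subst hc
    have had : a * d = 1 := by simpa using hdet
    have ha : a ≠ 0 := left_ne_zero_of_mul_eq_one had
    have hσ : (show SL(2, K) from ⟨!![a, b; 0, d], by rwa [Matrix.det_fin_two_of]⟩) =
        (show SL(2, K) from ⟨!![1, a * b; 0, 1], by simp [Matrix.det_fin_two_of]⟩) *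
          (show SL(2, K) from ⟨!![a, 0; 0, a⁻¹], by simp [Matrix.det_fin_two_of, mul_inv_cancel₀ ha]⟩) := by
      ext i j
      fin_cases i <;> fin_cases j
      · simp
      · simp; field_simp
      · simp
      · simp; exact eq_inv_of_mul_eq_one_right had
    dsimp only at hσ
    rw [L.sl2RepFun_apply_of_eq_zero hgr (show SL(2, K) from ⟨!![a, b; 0, d], by rwa [Matrix.det_fin_two_of]⟩) (by simp)]
    simp only [Matrix.of_apply, Matrix.cons_val', Matrix.cons_val_zero, Matrix.cons_val_one, Matrix.cons_val_fin_one]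
    rw [hσ, ← mul_assoc, L.sl2RepFun_mul_of_coe_eq_diagonal hgr _ _ ha rfl, L.sl2RepFun_mul_of_coe_eq_upper hgr _ _ rfl, mul_assoc]
  · have hσ : (show SL(2, K) from ⟨!![a, b; c, d], by rwa [Matrix.det_fin_two_of]⟩) =
        (show SL(2, K) from ⟨!![1, a / c; 0, 1], by simp [Matrix.det_fin_two_of]⟩) *
          (show SL(2, K) from ⟨!![0, -1; 1, 0], by simp [Matrix.det_fin_two_of]⟩) *
            (show SL(2, K) from ⟨!![c, 0; 0, c⁻¹], by simp [Matrix.det_fin_two_of, mul_inv_cancel₀ hc]⟩) *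
              (show SL(2, K) from ⟨!![1, d / c; 0, 1], by simp [Matrix.det_fin_two_of]⟩) := by
      ext i j
      fin_cases i <;> fin_cases j
      · simp; field_simp
      · simp; field_simp; linear_combination -hdet
      · simp
      · simp; field_simp
    dsimp only at hσ
    rw [L.sl2RepFun_apply_of_ne_zero hgr (show SL(2, K) from ⟨!![a, b; c, d], by rwa [Matrix.det_fin_two_of]⟩) (by simpa using hc)]
    simp only [Matrix.of_apply, Matrix.cons_val', Matrix.cons_val_zero, Matrix.cons_val_one, Matrix.cons_val_fin_one]
    rw [hσ, ← mul_assoc, ← mul_assoc, ← mul_assoc, L.sl2RepFun_mul_of_coe_eq_upper hgr _ _ rfl,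
      L.sl2RepFun_mul_of_coe_eq_diagonal hgr _ _ hc rfl, L.sl2RepFun_mul_of_coe_eq_weyl hgr _ _ rfl,
      L.sl2RepFun_mul_of_coe_eq_upper hgr _ _ rfl]
    simp only [mul_assoc]

/-- **THE REPRESENTATION `ρ : SL₂(K) → End_K(M)` OF A LEFSCHETZ MODULE** (a monoid homomorphism; its values are invertible):
Beauville's "morphism of ℚ-groups `φ : SL₂ → Corr(A)`" on its realisation, integrating the `𝔰𝔩₂`-triple `(e, h, f)`:
`(1 a ; 0 1) ↦ exp(a e)`, `(1 0 ; a 1) ↦ exp(a f)`, `(0 −1 ; 1 0) ↦ w`, `diag(t, t⁻¹) ↦ tʰ` (§4 below).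
[cite: Beauville2010SL2, §3 Theorem] [cite: Andre1996Motifs, §1.2 (p. 11)] -/
def sl2Rep (L : HasLefschetzProperty h e) (hgr : IsZGrading h) : SL(2, K) →* Module.End K M where
  toFun := L.sl2RepFun hgr
  map_one' := L.sl2RepFun_one hgr
  map_mul' := L.sl2RepFun_mul hgr

/-- `ρ γ = sl2RepFun γ` (unfolding). [cite: Beauville2010SL2, §3 Theorem] -/
theorem sl2Rep_apply (L : HasLefschetzProperty h e) (hgr : IsZGrading h) (γ : SL(2, K)) : L.sl2Rep hgr γ = L.sl2RepFun hgr γ := rfl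

/-! ### §4 The values: `ρ(1 a ; 0 1) = exp(a e)`, `ρ(diag(t, t⁻¹)) = tʰ`, `ρ(0 −1 ; 1 0) = w`, `ρ(1 0 ; a 1) = exp(a f)`, `ρ(−1) = w²` -/

/-- **`ρ(1 a ; 0 1) = exp(a e)`** — Beauville's "`φ(1 a ; 0 1) = Δ_* e^{aθ}`", "`(1 a ; 0 1)·z = e^{aθ} z`" (the cup product with
`e^{aθ}` is the exponential of the Lefschetz operator `θ ∧ ·`). [cite: Beauville2010SL2, §3 Theorem and §4 Theorem] -/
theorem sl2Rep_apply_of_coe_eq_upper (L : HasLefschetzProperty h e) (hgr : IsZGrading h) (γ : SL(2, K)) {a : K}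
    (hγ : (γ : Matrix (Fin 2) (Fin 2) K) = !![1, a; 0, 1]) :
    letI := Algebra.compHom (Module.End K M) (algebraMap ℚ K)
    L.sl2Rep hgr γ = IsNilpotent.exp (a • e) := by
  rw [sl2Rep_apply, L.sl2RepFun_apply_of_eq_zero hgr γ (by simp [hγ])]
  simp only [hγ, Matrix.of_apply, Matrix.cons_val', Matrix.cons_val_zero, Matrix.cons_val_one, Matrix.cons_val_fin_one, one_mul]
  rw [hgr.torus_one, mul_one]

/-- **`ρ(diag(t, t⁻¹)) = tʰ`** (`t^m` on `M_m`) — Beauville's "`φ(n 0 ; 0 n⁻¹) = n^{−g} Γ'_n`", "`(n 0 ; 0 n⁻¹)·z = n^{−g} n^*z`" (on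
`Hⁱ = M_{i−g}`, `n^* = nⁱ`). [cite: Beauville2010SL2, §3 Theorem and §4 Theorem] -/
theorem sl2Rep_apply_of_coe_eq_diagonal (L : HasLefschetzProperty h e) (hgr : IsZGrading h) (γ : SL(2, K)) {t : K}
    (hγ : (γ : Matrix (Fin 2) (Fin 2) K) = !![t, 0; 0, t⁻¹]) : L.sl2Rep hgr γ = hgr.torus t := by
  letI := Algebra.compHom (Module.End K M) (algebraMap ℚ K)
  rw [sl2Rep_apply, L.sl2RepFun_apply_of_eq_zero hgr γ (by simp [hγ])]
  simp only [hγ, Matrix.of_apply, Matrix.cons_val', Matrix.cons_val_zero, Matrix.cons_val_one, Matrix.cons_val_fin_one, mul_zero]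
  rw [exp_zero_smul, one_mul]

/-- **`ρ(0 −1 ; 1 0) = w`** — Beauville's "`φ(0 −1 ; 1 0) = d⁻¹ e^℘`", "`(0 −1 ; 1 0)·z = ℱ(z)`": the Weyl element of `SL₂` acts by the
Weyl operator `w = exp(f) exp(−e) exp(f)` (on `H•(X)` of a p.p.a.v.: the Fourier transform). [cite: Beauville2010SL2, §3 Theorem and §4 Theorem]
[cite: Andre1996Motifs, §1.2 (p. 11)] -/
theorem sl2Rep_apply_of_coe_eq_weyl (L : HasLefschetzProperty h e) (hgr : IsZGrading h) (γ : SL(2, K))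
    (hγ : (γ : Matrix (Fin 2) (Fin 2) K) = !![0, -1; 1, 0]) : L.sl2Rep hgr γ = L.weylOperator hgr := by
  letI := Algebra.compHom (Module.End K M) (algebraMap ℚ K)
  rw [sl2Rep_apply, L.sl2RepFun_apply_of_ne_zero hgr γ (by simp [hγ])]
  simp only [hγ, Matrix.of_apply, Matrix.cons_val', Matrix.cons_val_zero, Matrix.cons_val_one, Matrix.cons_val_fin_one, zero_div]
  rw [exp_zero_smul, one_mul, mul_one, hgr.torus_one, mul_one]

/-- **`ρ(1 0 ; a 1) = exp(a f)`** — Beauville's "`φ(1 0 ; a 1) = d⁻¹ a^g e^{δ^*θ/a}`", "`(1 0 ; a 1)·z = d⁻¹ a^g e^{θ/a} ⋆ z`" (on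
`H•(X)` the lower unipotents act through the Pontryagin product); here from the second braid relation
`cʰ w = exp(−c e) exp(c⁻¹ f) exp(−c e)` at `c = a⁻¹`. [cite: Beauville2010SL2, §3 Theorem and §4 Theorem] -/
theorem sl2Rep_apply_of_coe_eq_lower (L : HasLefschetzProperty h e) (hgr : IsZGrading h) (γ : SL(2, K)) {a : K}
    (hγ : (γ : Matrix (Fin 2) (Fin 2) K) = !![1, 0; a, 1]) :
    letI := Algebra.compHom (Module.End K M) (algebraMap ℚ K)
    L.sl2Rep hgr γ = IsNilpotent.exp (a • L.dual hgr) := by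
  letI := Algebra.compHom (Module.End K M) (algebraMap ℚ K)
  by_cases ha : a = 0
  · subst ha
    rw [zero_smul, IsNilpotent.exp_zero, ← hgr.torus_one]
    exact L.sl2Rep_apply_of_coe_eq_diagonal hgr γ (by rw [hγ, inv_one])
  have hX : ∀ s t : K, IsNilpotent.exp (s • e) * IsNilpotent.exp (t • e) = IsNilpotent.exp ((s + t) • e) :=
    exp_smul_mul_exp_smul (L.isNilpotent_of_hasLefschetzProperty hgr)
  have hB := L.torus_mul_weylOperator_eq_exp_e hgr (inv_ne_zero ha)
  rw [inv_inv, L.torus_mul_weylOperator hgr, inv_inv] at hB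
  rw [sl2Rep_apply, L.sl2RepFun_apply_of_ne_zero hgr γ (by simpa [hγ] using ha)]
  simp only [hγ, Matrix.of_apply, Matrix.cons_val', Matrix.cons_val_zero, Matrix.cons_val_one, Matrix.cons_val_fin_one, one_div]
  -- `exp(a⁻¹ e) (w aʰ) exp(a⁻¹ e) = exp(a⁻¹ e) exp(−a⁻¹ e) exp(a f) exp(−a⁻¹ e) exp(a⁻¹ e) = exp(a f)`
  calc IsNilpotent.exp (a⁻¹ • e) * L.weylOperator hgr * hgr.torus a * IsNilpotent.exp (a⁻¹ • e)
      = IsNilpotent.exp (a⁻¹ • e) * (L.weylOperator hgr * hgr.torus a) * IsNilpotent.exp (a⁻¹ • e) := by simp only [mul_assoc]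
    _ = (IsNilpotent.exp (a⁻¹ • e) * IsNilpotent.exp (-(a⁻¹ • e))) * IsNilpotent.exp (a • L.dual hgr) *
          (IsNilpotent.exp (-(a⁻¹ • e)) * IsNilpotent.exp (a⁻¹ • e)) := by rw [hB]; simp only [mul_assoc]
    _ = IsNilpotent.exp (a • L.dual hgr) := by
        rw [← neg_smul, hX, hX, add_neg_cancel, neg_add_cancel, exp_zero_smul, one_mul, mul_one]

/-- **`ρ(−1) = (−1)ʰ = w²`**: the centre `−I` acts by the parity of the weight. [cite: Beauville2010SL2, §3 Proposition (ii) ("h² = β(−I)")] -/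
theorem sl2Rep_neg_one (L : HasLefschetzProperty h e) (hgr : IsZGrading h) :
    L.sl2Rep hgr (-1) = L.weylOperator hgr * L.weylOperator hgr := by
  rw [L.weylOperator_mul_weylOperator hgr]
  exact L.sl2Rep_apply_of_coe_eq_diagonal hgr (-1) (by
    rw [Matrix.SpecialLinearGroup.coe_neg, Matrix.SpecialLinearGroup.coe_one, inv_neg, inv_one]
    ext i j; fin_cases i <;> fin_cases j <;> simp)

/-- The values on Mathlib's transvections `1 + c E₀₁`, `1 + c E₁₀` of `SL(2, K)`. [cite: Beauville2010SL2, §3 Theorem] -/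
theorem sl2Rep_transvection (L : HasLefschetzProperty h e) (hgr : IsZGrading h) {i j : Fin 2} (hij : i ≠ j) (c : K) :
    letI := Algebra.compHom (Module.End K M) (algebraMap ℚ K)
    L.sl2Rep hgr (Matrix.SpecialLinearGroup.transvection hij c) =
      if i = 0 then IsNilpotent.exp (c • e) else IsNilpotent.exp (c • L.dual hgr) := by
  fin_cases i <;> fin_cases j
  · exact absurd rfl hij
  · exact L.sl2Rep_apply_of_coe_eq_upper hgr _ (by
      ext i j; fin_cases i <;> fin_cases j <;>
        simp [Matrix.SpecialLinearGroup.transvection, Matrix.transvection, Matrix.single])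
  · exact L.sl2Rep_apply_of_coe_eq_lower hgr _ (by
      ext i j; fin_cases i <;> fin_cases j <;>
        simp [Matrix.SpecialLinearGroup.transvection, Matrix.transvection, Matrix.single])
  · exact absurd rfl hij

/-- **UNIQUENESS**: a homomorphism `SL₂(K) → End_K(M)` with `(1 a ; 0 1) ↦ exp(a e)` and `(1 0 ; a 1) ↦ exp(a f)` IS `ρ`
(`SL₂(K)` is generated by its elementary unipotents — Mathlib's `Matrix.SL2.transvection_induction`); in particular `ρ` is the
unique integration of the `𝔰𝔩₂`-triple `(e, h, f)`, Beauville's "(unique) morphism". [cite: Beauville2010SL2, §3 Proposition ("there is a (unique) morphism … extending β and mapping w to h")] -/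
theorem sl2Rep_unique (L : HasLefschetzProperty h e) (hgr : IsZGrading h) (ρ : SL(2, K) →* Module.End K M)
    (hupper : ∀ (γ : SL(2, K)) (a : K), (γ : Matrix (Fin 2) (Fin 2) K) = !![1, a; 0, 1] →
      letI := Algebra.compHom (Module.End K M) (algebraMap ℚ K); ρ γ = IsNilpotent.exp (a • e))
    (hlower : ∀ (γ : SL(2, K)) (a : K), (γ : Matrix (Fin 2) (Fin 2) K) = !![1, 0; a, 1] →
      letI := Algebra.compHom (Module.End K M) (algebraMap ℚ K); ρ γ = IsNilpotent.exp (a • L.dual hgr)) :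
    ρ = L.sl2Rep hgr := by
  refine MonoidHom.ext fun γ ↦ Matrix.SL2.transvection_induction (fun γ ↦ ρ γ = L.sl2Rep hgr γ) (fun i j hij c ↦ ?_)
    (fun A B hA hB ↦ by rw [map_mul, map_mul, hA, hB]) γ
  fin_cases i <;> fin_cases j
  · exact absurd rfl hij
  · have hc : ((Matrix.SpecialLinearGroup.transvection hij c : SL(2, K)) : Matrix (Fin 2) (Fin 2) K) = !![1, c; 0, 1] := by
      ext i j; fin_cases i <;> fin_cases j <;>
        simp [Matrix.SpecialLinearGroup.transvection, Matrix.transvection, Matrix.single]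
    rw [hupper _ c hc, L.sl2Rep_apply_of_coe_eq_upper hgr _ hc]
  · have hc : ((Matrix.SpecialLinearGroup.transvection hij c : SL(2, K)) : Matrix (Fin 2) (Fin 2) K) = !![1, 0; c, 1] := by
      ext i j; fin_cases i <;> fin_cases j <;>
        simp [Matrix.SpecialLinearGroup.transvection, Matrix.transvection, Matrix.single]
    rw [hlower _ c hc, L.sl2Rep_apply_of_coe_eq_lower hgr _ hc]
  · exact absurd rfl hij

/-- **`ρ(γ)` maps `M_m` into `⊕ M`; on the torus and Weyl element it is graded**: `ρ(diag(t,t⁻¹)) M_m ⊆ M_m`, `ρ(w) M_m ⊆ M_{−m}`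
(restated for convenience from `torus_apply_mem`, `weylOperator_apply_mem`). [cite: Beauville2010SL2, §4 Theorem (H z = (2p − g − s) z)] -/
theorem sl2Rep_apply_mem_of_coe_eq_weyl (L : HasLefschetzProperty h e) (hgr : IsZGrading h) (γ : SL(2, K))
    (hγ : (γ : Matrix (Fin 2) (Fin 2) K) = !![0, -1; 1, 0]) {m : ℤ} {x : M} (hx : x ∈ degreeSpace h m) :
    L.sl2Rep hgr γ x ∈ degreeSpace h (-m) := by
  rw [L.sl2Rep_apply_of_coe_eq_weyl hgr γ hγ]
  exact L.weylOperator_apply_mem hgr hx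

/-- **`ρ(γ) ∈ K[e, f]`** for every `γ ∈ SL₂(K)`: the representation takes values in the subalgebra generated by the Lefschetz operator
and its partner (the torus `tʰ` is the product of the values on unipotents and `w`, all in `K[e, f]`). On `H•(X)` this is Milne's
"all elements of `ℚ[L, Λ]` are Lefschetz". [cite: Beauville2010SL2, §3 Theorem] [cite: Andre1996Motifs, Prop. 1.2 (p. 11)] -/
theorem sl2Rep_mem_adjoin_pair_dual (L : HasLefschetzProperty h e) (hgr : IsZGrading h) (γ : SL(2, K)) :
    L.sl2Rep hgr γ ∈ Algebra.adjoin K ({e, L.dual hgr} : Set (Module.End K M)) := by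
  refine Matrix.SL2.transvection_induction (fun γ ↦ L.sl2Rep hgr γ ∈ Algebra.adjoin K ({e, L.dual hgr} : Set (Module.End K M)))
    (fun i j hij c ↦ ?_) (fun A B hA hB ↦ by rw [map_mul]; exact Subalgebra.mul_mem _ hA hB) γ
  rw [L.sl2Rep_transvection hgr hij c]
  split_ifs
  · exact (L.exp_smul_mem_adjoin_pair_dual hgr c).1
  · exact (L.exp_smul_mem_adjoin_pair_dual hgr c).2

end HasLefschetzProperty

end Literature.Algebra.Lie
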